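import Summits.BirchSwinnertonDyer.BirchSwinnertonDyer.Theorems.SylvesterTwoHeegnerIndexCMFlipLevelPairPrep
import Summits.BirchSwinnertonDyer.BirchSwinnertonDyer.Theorems.SylvesterTwoHeegnerIndexCMFlipCoherentFrame
import Summits.BirchSwinnertonDyer.BirchSwinnertonDyer.Theorems.SylvesterTwoHeegnerIndexCMDataPairTrace
import Summits.BirchSwinnertonDyer.BirchSwinnertonDyer.Theorems.SylvesterTwoHeegnerIndexCMDataCoupledFrame
import Summits.BirchSwinnertonDyer.Rank1Residual.X11b.RingClassTowerRestriction
import Summits.BirchSwinnertonDyer.Rank1Residual.X11b.KolyvaginRingClassCardinality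
import Literature.NumberTheory.EllipticCurves.CMPointsCongruenceRelation
import Literature.NumberTheory.EllipticCurves.RingClassFieldFrobenius
import HarnessLib

/-!
# (H-c1) of leaf (L1), crux `UpperOffV0HSYPlus` (stmt-BirchSwinnertonDyer-19804): the pair-level plumbing of the
# rows' assembly — derivatives along inclusions, LIFTING GENERATORS, and (ES2) γ-wise at the pair level

Skeleton of record VARIANT M (`Cruxes/UpperOffV0HSYPlus/Lines/coupled_variantM.lean` 406ca288e244d392);
card v28; planner D472/D475.  Three theorems used by #H-c2 `block2_of_level` and the assembly #H-d:

* `derivOp_map_inclusion`: `D_{σ,ℓ}(y↑) = (D_{σ₀,ℓ} y)↑` along `K[m'] ⊆ K[m]` when `σ ∘ incl = incl ∘ σ₀`;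
* `exists_generator_lift`: a generator `σ_{ℓ'}` of `Gal(K[9pℓ']/K[9p])` LIFTS to a generator of
  `Gal(K[m]/K[9pℓ])`, `m = 9pℓℓ'` (a free variable), restricting to `σ_{ℓ'}` — x11b3's restriction `res`,
  `exists_mem_ringClassGalOver_restrictHom_eq`, `exists_mul_eq_of_mem_ringClassGalOver` (with the ring-class-group
  input `ker_restrict_le_ker_sup_ker`, as in #R-e1), and the order count `card_ringClassGalOver_div_eq_succ`;
* `geomReduction_pair_eq_frob_smul`: #F2's displayed `hES` DISCHARGED by `Nekovar2007.cmPoint_frobeniusCongruence`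
  (#20 `geomReduction_sylvesterTower_eq_frob_smul` at `n = ℓ'`, level read at `9p(ℓℓ')`).

Theorems only; no `def`, no `sorry`, no new `Prop`.  Honest label: (F)+(G)+(H) close `stub_layerL1Four` only
MODULO {`hD` #19, `Dt`/`hdeg`, (ES2) = `Nekovar2007.cmPoint_frobeniusCongruence`}; BSD is not proved by any of this.
-/

set_option linter.dupNamespace false
set_option autoImplicit false

noncomputable section

open scoped Classical Pointwise

namespace Summit.BirchSwinnertonDyer.BirchSwinnertonDyer.Theorems.SylvesterTwoCMFlip

open WeierstrassCurve Field NumberField IsDedekindDomain Finset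
open Literature.NumberTheory.EllipticCurves Literature.NumberTheory.GaloisRepresentations
  Literature.NumberTheory.EllipticCurves.ModularForms
  Literature.NumberTheory.EllipticCurves.HuShuYin2019
  Literature.NumberTheory.EllipticCurves.KolyvaginCocycle
  Literature.NumberTheory.EllipticCurves.RingClassField
  Literature.NumberTheory.QuadraticFields Literature.NumberTheory.QuadraticFields.RingClass
  Literature.NumberTheory.QuadraticFields.Quadratic
  Summit.BirchSwinnertonDyer.BirchSwinnertonDyer.Theorems.SylvesterTwoCMData
  Summit.BirchSwinnertonDyer.Rank1Residual.X11b Summit.BirchSwinnertonDyer.Rank1Residual.X11b.RingClassTower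

variable {K : Type} [Field K] [NumberField K]

/-- **The derivative operator commutes with the base change `E(K[m']) → E(K[m])` along an inclusion**, for
automorphisms `σ` of `K[m]` and `σ₀` of `K[m']` with `σ ∘ incl = incl ∘ σ₀`:
`D_{σ,ℓ}(y↑) = (D_{σ₀,ℓ} y)↑` (`D = Σ i σ^i`, `incl` additive). [cite: GrossLMS1991, §3 (3.5), §4 (4.1)] -/
theorem derivOp_map_inclusion {W : WeierstrassCurve ℚ} (ι : K →+* ℂ) {m' m : ℕ}
    (hle : ringClassField K ι m' ≤ ringClassField K ι m)
    {σ : ringClassField K ι m ≃ₐ[ℚ] ringClassField K ι m}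
    {σ₀ : ringClassField K ι m' ≃ₐ[ℚ] ringClassField K ι m'}
    (hσ : ∀ x : ringClassField K ι m', σ (RingClassField.inclusion ι hle x) = RingClassField.inclusion ι hle (σ₀ x))
    (ℓ : ℕ) (y : (W.baseChange (ringClassField K ι m')).toAffine.Point) :
    KolyvaginOperator.derivOp (pointGalHom W (ringClassField K ι m)) σ ℓ
        (Affine.Point.map (W' := W) ((RingClassField.inclusion ι hle).restrictScalars ℚ) y) =
      Affine.Point.map (W' := W) ((RingClassField.inclusion ι hle).restrictScalars ℚ)
        (KolyvaginOperator.derivOp (pointGalHom W (ringClassField K ι m')) σ₀ ℓ y) := by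
  have hFG : ((σ : ringClassField K ι m ≃ₐ[ℚ] ringClassField K ι m) :
        ringClassField K ι m →ₐ[ℚ] ringClassField K ι m).comp ((RingClassField.inclusion ι hle).restrictScalars ℚ) =
      ((RingClassField.inclusion ι hle).restrictScalars ℚ).comp
        (σ₀ : ringClassField K ι m' ≃ₐ[ℚ] ringClassField K ι m') :=
    AlgHom.ext fun x ↦ hσ x
  have hone : ∀ P : (W.baseChange (ringClassField K ι m')).toAffine.Point,
      pointGalHom W (ringClassField K ι m) σ
          (Affine.Point.map (W' := W) ((RingClassField.inclusion ι hle).restrictScalars ℚ) P) =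
        Affine.Point.map (W' := W) ((RingClassField.inclusion ι hle).restrictScalars ℚ)
          (pointGalHom W (ringClassField K ι m') σ₀ P) := fun P ↦ by
    rw [pointGalHom_apply, pointGalHom_apply, Affine.Point.map_map, Affine.Point.map_map, hFG]
  have hpow : ∀ (i : ℕ) (P : (W.baseChange (ringClassField K ι m')).toAffine.Point),
      pointGalHom W (ringClassField K ι m) (σ ^ i)
          (Affine.Point.map (W' := W) ((RingClassField.inclusion ι hle).restrictScalars ℚ) P) =
        Affine.Point.map (W' := W) ((RingClassField.inclusion ι hle).restrictScalars ℚ)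
          (pointGalHom W (ringClassField K ι m') (σ₀ ^ i) P) := by
    intro i
    induction i with
    | zero => intro P; rw [pow_zero, pow_zero, map_one, map_one, AddMonoid.End.one_apply, AddMonoid.End.one_apply]
    | succ i ih =>
      intro P
      rw [pow_succ, pow_succ, map_mul, map_mul, AddMonoid.End.coe_mul, AddMonoid.End.coe_mul, Function.comp_apply,
        Function.comp_apply, hone, ih]
  simp only [KolyvaginOperator.derivOp, map_sum, map_nsmul, hpow]

/-- **LIFTING A GENERATOR `σ_ℓ'` OF `Gal(K[9pℓ']/K[9p])` TO A GENERATOR OF `Gal(K[9pℓℓ']/K[9pℓ])`.**  For distinct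
Kolyvagin primes `ℓ, ℓ' ∤ 9p` inert in `K`: lift `σ_ℓ'` to `g₀ ∈ Gal(K[9pℓℓ']/K[9p])` (x11b3
`exists_mem_ringClassGalOver_restrictHom_eq`), split `g₀ = y · z` along
`Gal(K[n]/K[9p]) = Gal(K[n]/K[9pℓ']) · Gal(K[n]/K[9pℓ])` (#R-e1's `ker_restrict_le_ker_sup_ker` through x11b3
`exists_mul_eq_of_mem_ringClassGalOver`), so `z|_{K[9pℓ']} = σ_ℓ'`; `z` generates `Gal(K[n]/K[9pℓ])` because both
have order `ℓ' + 1` (Gross's `G_n ≃ ∏ G_ℓ`).  The level is a free variable `m = 9p(ℓℓ')` (to be read at `9pn` for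
`n = ℓℓ'` or `ℓ'ℓ`). [cite: GrossLMS1991, §3 (p. 238–239: G_n = ∏ G_ℓ, G_ℓ cyclic of order ℓ+1)] -/
theorem exists_generator_lift (hK : IsImaginaryQuadratic K) (ι : K →+* ℂ)
    {p ℓ ℓ' : ℕ} (hp0 : p ≠ 0) (hℓ : ℓ.Prime) (hℓ' : ℓ'.Prime) (hne : ℓ ≠ ℓ') (hℓ9p : ¬ ℓ ∣ 9 * p)
    (hℓ'9p : ¬ ℓ' ∣ 9 * p) (hinert' : (Ideal.span {(ℓ' : 𝓞 K)}).IsPrime) {m : ℕ} (hm : 9 * p * (ℓ * ℓ') = m)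
    (hle : ringClassField K ι (9 * p * ℓ') ≤ ringClassField K ι m)
    {σ₀ : ringClassField K ι (9 * p * ℓ') ≃ₐ[ℚ] ringClassField K ι (9 * p * ℓ')}
    (hσ₀ : Subgroup.zpowers σ₀ = ringClassGalOver ι (9 * p * ℓ') (9 * p)) :
    ∃ σ' : ringClassField K ι m ≃ₐ[ℚ] ringClassField K ι m,
      Subgroup.zpowers σ' = ringClassGalOver ι m (9 * p * ℓ) ∧
      ∀ x : ringClassField K ι (9 * p * ℓ'),
        σ' (RingClassField.inclusion ι hle x) = RingClassField.inclusion ι hle (σ₀ x) := by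
  subst hm
  have hf : 9 * p ≠ 0 := mul_ne_zero (by norm_num) hp0
  have hm0 : 9 * p * ℓ' ≠ 0 := mul_ne_zero hf hℓ'.ne_zero
  have hn0 : 9 * p * (ℓ * ℓ') ≠ 0 := mul_ne_zero hf (mul_ne_zero hℓ.ne_zero hℓ'.ne_zero)
  have hmn : 9 * p * ℓ' ∣ 9 * p * (ℓ * ℓ') := ⟨ℓ, by ring⟩
  have hb : 9 * p * ℓ ∣ 9 * p * (ℓ * ℓ') := ⟨ℓ', by ring⟩
  have hd : 9 * p ∣ 9 * p * (ℓ * ℓ') := dvd_mul_right _ _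
  obtain ⟨res, hres⟩ := exists_restrictHom hK ι hmn hn0
  have hσ₀mem : σ₀ ∈ ringClassGalOver ι (9 * p * ℓ') (9 * p) := hσ₀ ▸ Subgroup.mem_zpowers σ₀
  have h9p_le : ringClassField K ι (9 * p) ≤ ringClassField K ι (9 * p * ℓ') :=
    ringClassField_nine_mul_le hK ι hp0 hℓ'.ne_zero
  obtain ⟨g₀, hg₀, hresg₀⟩ := exists_mem_ringClassGalOver_restrictHom_eq hK ι hmn hn0 hres h9p_le hσ₀mem
  -- ### `Gal(K[n]/K[9p]) = Gal(K[n]/K[9pℓ']) · Gal(K[n]/K[9pℓ])` at the ring-class-group level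
  have hG1 : ∀ x : RingClassGroup K (9 * p * (ℓ * ℓ')), RingClass.restrict hd x = 1 →
      ∃ y z : RingClassGroup K (9 * p * (ℓ * ℓ')), RingClass.restrict hmn y = 1 ∧ RingClass.restrict hb z = 1 ∧
        x = y * z := by
    intro x hx
    obtain ⟨bs, hbs⟩ := exists_basis_zero_eq_one hK.1
    have hω := basis_one_mul_self_eq bs hbs
    have hℓℓ' : Nat.Coprime ℓ ℓ' := (Nat.coprime_primes hℓ hℓ').mpr hne
    have hℓd : Nat.Coprime ℓ (9 * p) := (Nat.Prime.coprime_iff_not_dvd hℓ).mpr hℓ9p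
    have hℓ'd : Nat.Coprime ℓ' (9 * p) := (Nat.Prime.coprime_iff_not_dvd hℓ').mpr hℓ'9p
    have hfn : Ideal.span {((9 * p * (ℓ * ℓ') : ℕ) : 𝓞 K)} ≠ ⊤ :=
      span_natCast_ne_top_of_ne_one bs hbs (by
        intro h
        have h1 : 1 ≤ p * (ℓ * ℓ') :=
          Nat.one_le_iff_ne_zero.mpr (mul_ne_zero hp0 (mul_ne_zero hℓ.ne_zero hℓ'.ne_zero))
        have h2 : 9 * p * (ℓ * ℓ') = 9 * (p * (ℓ * ℓ')) := by ring
        omega)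
    have hker := ker_restrict_le_ker_sup_ker (K := K) bs hbs hω (ℓ := ℓ) (c := ℓ') (d := 9 * p)
      (m₁ := 9 * p * ℓ') (m₂ := 9 * p * ℓ) (n := 9 * p * (ℓ * ℓ')) (by ring) (by ring) (by ring)
      hℓℓ' hℓd hℓ'd hfn hd hmn hb
    set A : Subgroup (RingClassGroup K (9 * p * (ℓ * ℓ'))) := (RingClass.restrict (K := K) hmn).ker with hA
    set B : Subgroup (RingClassGroup K (9 * p * (ℓ * ℓ'))) := (RingClass.restrict (K := K) hb).ker with hB
    have hx' : x ∈ (RingClass.restrict (K := K) hd).ker := (MonoidHom.mem_ker).mpr hx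
    have hset : x ∈ ((A ⊔ B : Subgroup (RingClassGroup K (9 * p * (ℓ * ℓ')))) :
        Set (RingClassGroup K (9 * p * (ℓ * ℓ')))) := hker hx'
    rw [Subgroup.mul_normal A B] at hset
    obtain ⟨y, hy, z, hz, hyz⟩ := Set.mem_mul.mp hset
    exact ⟨y, z, (MonoidHom.mem_ker).mp hy, (MonoidHom.mem_ker).mp hz, hyz.symm⟩
  obtain ⟨y, hy, z, hz, hyz⟩ := exists_mul_eq_of_mem_ringClassGalOver hK ι hn0 hmn hb hd hG1 hg₀
  have hyG : y ∈ ringClassGal ι (9 * p * (ℓ * ℓ')) := ringClassGalOver_le_ringClassGal ι _ _ hy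
  have hzG : z ∈ ringClassGal ι (9 * p * (ℓ * ℓ')) := ringClassGalOver_le_ringClassGal ι _ _ hz
  have hg₀e : g₀ = ⟨y, hyG⟩ * ⟨z, hzG⟩ := Subtype.ext hyz
  have hresz : res ⟨z, hzG⟩ = σ₀ := by
    have h1 : res ⟨y, hyG⟩ = 1 := restrictHom_eq_one_of_mem hK ι hmn hn0 hres ⟨y, hyG⟩ hy
    rw [← hresg₀, hg₀e, map_mul, h1, one_mul]
  refine ⟨z, ?_, fun x ↦ ?_⟩
  · -- ### `z` generates `Gal(K[n]/K[9pℓ])`: orders `ℓ' + 1` on both sides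
    have hle' : Subgroup.zpowers z ≤ ringClassGalOver ι (9 * p * (ℓ * ℓ')) (9 * p * ℓ) :=
      (Subgroup.zpowers_le).mpr hz
    have hdiv : 9 * p * (ℓ * ℓ') / ℓ' = 9 * p * ℓ := by
      rw [show 9 * p * (ℓ * ℓ') = 9 * p * ℓ * ℓ' by ring]; exact Nat.mul_div_cancel _ hℓ'.pos
    have hcard : Nat.card (ringClassGalOver ι (9 * p * (ℓ * ℓ')) (9 * p * ℓ)) = ℓ' + 1 := by
      have h := card_ringClassGalOver_div_eq_succ hK ι hℓ' hinert' (⟨9 * p * ℓ, by ring⟩ : ℓ' ∣ 9 * p * (ℓ * ℓ'))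
        (by rw [hdiv]; exact fun h ↦ hℓ'9p ((Nat.Prime.dvd_mul hℓ').mp h |>.resolve_right
          (fun h' ↦ hne ((Nat.prime_dvd_prime_iff_eq hℓ' hℓ).mp h').symm)))
        hn0 (by rw [hdiv]; left; have := hℓ.two_le; nlinarith [Nat.one_le_iff_ne_zero.mpr hf])
      rwa [hdiv] at h
    have hord₀ : orderOf σ₀ = ℓ' + 1 := orderOf_eq_succ_sylvester_prime hK ι hp0 hℓ' hℓ'9p hinert' hσ₀
    haveI : Finite (ringClassGalOver ι (9 * p * (ℓ * ℓ')) (9 * p * ℓ)) := Nat.finite_of_card_ne_zero (by omega)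
    have hdvd₁ : ℓ' + 1 ∣ orderOf z := by
      rw [← hord₀, ← hresz]
      have h := orderOf_map_dvd res ⟨z, hzG⟩
      rwa [← Subgroup.orderOf_coe, Subgroup.coe_mk] at h
    have hdvd₂ : orderOf z ∣ ℓ' + 1 := by
      rw [← hcard, ← Nat.card_zpowers]
      exact Subgroup.card_dvd_of_le hle'
    have hord : orderOf z = ℓ' + 1 := Nat.dvd_antisymm hdvd₂ hdvd₁
    exact Subgroup.eq_of_le_of_card_ge hle' (by rw [hcard, Nat.card_zpowers, hord])
  · -- ### the restriction property, from the value formula of `res`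
    apply Subtype.ext
    have h := hres ⟨z, hzG⟩ x (RingClassField.inclusion ι hle x) (by rw [RingClassField.coe_inclusion])
    rw [hresz] at h
    rw [RingClassField.coe_inclusion, h]

/-- **(ES2) γ-wise at the conductors `(9pℓℓ', 9pℓ')` — the `hES` of #F2 `flip_levelPair` DISCHARGED by
`Nekovar2007.cmPoint_frobeniusCongruence`** (#20 `geomReduction_sylvesterTower_eq_frob_smul` at `n = ℓ'`; the level is a
free variable `m = 9p(ℓ'ℓ)` so that the statement can be read at #F2's level `9p(ℓℓ')`).
[cite: Nekovar2007, Prop. 4.9] [cite: GrossLMS1991, Prop. 3.7 (2), Prop. 6.2 (2)] -/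
theorem geomReduction_pair_eq_frob_smul (hES2 : Nekovar2007.cmPoint_frobeniusCongruence)
    (hK : IsImaginaryQuadratic K) (hdK : NumberField.discr K = -3) (ι : K →+* ℂ)
    {W : WeierstrassCurve ℚ} [W.IsElliptic] [W.IsGloballyMinimal]
    (Dt : ModularParametrizationData W 243) {p ℓ ℓ' : ℕ} (hp : p % 3 = 1) [Fact ℓ.Prime] (hℓ2 : ℓ ≠ 2)
    (hℓ3 : ℓ % 3 = 2) (hℓ' : ℓ'.Prime) (hℓ'3 : ℓ' % 3 = 2) (hne : ℓ ≠ ℓ') (hℓp : ¬ ℓ ∣ p)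
    (hinert : (Ideal.span {(ℓ : 𝓞 K)}).IsPrime) {m : ℕ} (hm : 9 * p * (ℓ' * ℓ) = m)
    {y y₀ : (W.baseChange (ringClassField K ι m)).toAffine.Point}
    (hy : WeierstrassCurve.Affine.Point.map (W' := W) (ringClassField K ι m).subtype.toRatAlgHom y =
      Dt.φ (heegnerTau (((ℓ * ℓ' : ℕ) : ℤ) ^ 2 * (81 * ((p : ℤ) ^ 2 + 4 * p + 16)),
        ((ℓ * ℓ' : ℕ) : ℤ) * (-(9 * (4 * (p : ℤ) ^ 2 + 17 * p + 72))), 4 * (p : ℤ) ^ 2 + 18 * p + 81)))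
    (hy₀ : WeierstrassCurve.Affine.Point.map (W' := W) (ringClassField K ι m).subtype.toRatAlgHom y₀ =
      Dt.φ (heegnerTau ((ℓ' : ℤ) ^ 2 * (81 * ((p : ℤ) ^ 2 + 4 * p + 16)),
        (ℓ' : ℤ) * (-(9 * (4 * (p : ℤ) ^ 2 + 17 * p + 72))), 4 * (p : ℤ) ^ 2 + 18 * p + 81)))
    (j : (W.baseChange (ringClassField K ι m)).toAffine.Point →+ geomPoints (W.baseChange K))
    (e₀ : ringClassField K ι m →+* AlgebraicClosure K)
    (hj : ∀ {a b : ringClassField K ι m} (hab : (W.baseChange (ringClassField K ι m)).toAffine.Nonsingular a b),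
      ∃ h', j (.some a b hab) = .some (e₀ a) (e₀ b) h')
    (hΔ : ¬ (ℓ : ℤ) ∣ minimalDiscriminantInt W) {φ₀ : absoluteGaloisGroup (ZMod ℓ)}
    (hφ₀ : ∀ x : AlgebraicClosure (ZMod ℓ), φ₀ • x = x ^ ℓ) (g : absoluteGaloisGroup K)
    (γ : ringClassField K ι m ≃ₐ[ℚ] ringClassField K ι m) :
    geomReduction hΔ ((RatClosure.pointsEquiv (K := K) W).symm
        (g • j (pointGalHom W (ringClassField K ι m) γ y))) =
      φ₀ • geomReduction hΔ ((RatClosure.pointsEquiv (K := K) W).symm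
        (g • j (pointGalHom W (ringClassField K ι m) γ y₀))) := by
  subst hm
  rw [Nat.mul_comm ℓ ℓ'] at hy
  exact geomReduction_sylvesterTower_eq_frob_smul hES2 hK hdK ι Dt hp hℓ'.ne_zero
    (fun q hq ↦ by rw [hℓ'.primeFactors, Finset.mem_singleton] at hq; rw [hq]; exact hℓ'3) hℓ2 hℓ3
    (fun h ↦ by
      rcases (Nat.Prime.dvd_mul Fact.out).mp h with h1 | h2'
      · exact hℓp h1
      · exact hne ((Nat.prime_dvd_prime_iff_eq Fact.out hℓ').mp h2'))
    hinert hy hy₀ j e₀ hj hΔ hφ₀ g γ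

end Summit.BirchSwinnertonDyer.BirchSwinnertonDyer.Theorems.SylvesterTwoCMFlip

end
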